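import Summits.AnomalousDissipation.AnomalousDissipation.Theorems.SolenoidalFractalHomogenisationLagrangianStepD1TailKernelDefs
import HarnessLib

/-!
# K1L_D `stub_D1_residueTail` (registry v17, stmt-AnomalousDissipation-27980) — lane A1 `hstruct`: THE SLOT-PAIR PRESENTATION OF THE TAIL
# (helper; `--supports stmt-AnomalousDissipation-27980`)

Summits-side helper file of route `SolenoidalFractalHomogenisation` (prover seat `ad-sawtooth-k1loc-p1` g13, lane A owner; input `hstruct` of the landed
tail certificate `D1TailCert.relSmall_tail_of_table`, memo `Lines/onelevel-D1-tail-cert.md` §1).  Everything proved; no definitions, no named facts, no sorry.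
* `bsymb_eq_sum_sum` — `bsymb R k p q = Σ_{i,l} pᵢ q_l Σ_{a,b} R i a l b k_a k_b`;
* `sum_sum_psiStar_mul_mul` — the index placement of `psiStar` (real test vectors): `Σ_{a,b} psiStar i a l b k_a k_b = (ν/4π²) Σ_{j,j'} (eⱼ·k)(e_{j'}·k) Mre j j' i l`;
* `diag_fresh_sum`, `pair_fresh_sum` — the fresh parts re-summed over ordered slot pairs are `bsymb excQS` and `bsymb pairQS` (`bsymb_excQS`, `bsymb_pairQS`);
* **`bsymb_tail_eq_slotPair`** — for `ν > 0` and ALL `k p q`: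
  `bsymb (psiStar cubatureWord MB MB_pos ν S − excQS cubatureWord MB S − pairQS S) k p q = Σ_{j,j'} ek j k · ek j' k · tailKernel ν S p q j j'` — the hypothesis
  `hstruct` of `D1TailCert.relSmall_tail_of_table` / `residueTail_of_slotPairBounds` with `F := tailKernel` (`…D1TailKernelDefs`).
NOT a proof of the registered stub (the per-pair bounds `hbound` are separate), of the crux, or of anomalous dissipation; rung leaf F-D1 infrastructure.
-/

set_option linter.dupNamespace false

noncomputable section

namespace Summit.AnomalousDissipation.AnomalousDissipation.Theorems.SolenoidalFractalHomogenisation.LagrangianStep.D1Tail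

open Summit.AnomalousDissipation.AnomalousDissipation.Theorems
open Summit.AnomalousDissipation.AnomalousDissipation.Theorems.SolenoidalFractalHomogenisation.LagrangianStep
open Summit.AnomalousDissipation.AnomalousDissipation.Theorems.SolenoidalFractalHomogenisation.LagrangianStep.WCrossing
open Summit.AnomalousDissipation.AnomalousDissipation.Theorems.SolenoidalFractalHomogenisation.LagrangianStep.D1ResidueCert
open Summit.AnomalousDissipation.AnomalousDissipation.Theorems.SolenoidalFractalHomogenisation.LagrangianStep.D1TailCert
open Literature.Analysis Literature.Analysis.FluidPDE Literature.Analysis.FunctionSpaces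
open Set Real

/-! ## §1 Sum bookkeeping -/

/-- `bsymb R k p q = Σ_{i,l} pᵢ q_l (Σ_{a,b} R i a l b k_a k_b)`. [cite: Frisch1995Turbulence, §9.6.3 p. 233] -/
theorem bsymb_eq_sum_sum (R : T4) (k p q : Fin 3 → ℝ) :
    Torus.bsymb R k p q = ∑ i, ∑ l, p i * q l * ∑ a, ∑ b, R i a l b * k a * k b := by
  unfold Torus.bsymb
  refine Finset.sum_congr rfl fun i _ => ?_
  rw [Finset.sum_comm]
  refine Finset.sum_congr rfl fun l _ => ?_
  rw [Finset.mul_sum]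
  refine Finset.sum_congr rfl fun a _ => ?_
  rw [Finset.mul_sum]
  refine Finset.sum_congr rfl fun b _ => ?_
  ring

/-- Four-fold reindexing `(a,b,j,j') → (j,j',a,b)`. [folklore] -/
theorem sum4_comm {α β : Type*} [Fintype α] [Fintype β] (F : α → α → β → β → ℝ) :
    ∑ a, ∑ b, ∑ j, ∑ j', F a b j j' = ∑ j, ∑ j', ∑ a, ∑ b, F a b j j' := by
  calc ∑ a, ∑ b, ∑ j, ∑ j', F a b j j'
      = ∑ a, ∑ j, ∑ b, ∑ j', F a b j j' := Finset.sum_congr rfl fun a _ => Finset.sum_comm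
    _ = ∑ j, ∑ a, ∑ b, ∑ j', F a b j j' := Finset.sum_comm
    _ = ∑ j, ∑ a, ∑ j', ∑ b, F a b j j' :=
        Finset.sum_congr rfl fun j _ => Finset.sum_congr rfl fun a _ => Finset.sum_comm
    _ = ∑ j, ∑ j', ∑ a, ∑ b, F a b j j' := Finset.sum_congr rfl fun j _ => Finset.sum_comm

/-- **The index placement of `psiStar`** (real test vector `k`, `ν > 0`):
`Σ_{a,b} psiStar i a l b · k_a k_b = (ν/4π²) · Σ_{j,j'} (eⱼ·k)(e_{j'}·k) · Mre ν S j j' i l`. [cite: MajdaKramer1999, §2.2.1.3 (55)] -/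
theorem sum_sum_psiStar_mul_mul {ν : ℝ} (hν : 0 < ν) (S : T4) (k : Fin 3 → ℝ) (i l : Fin 3) :
    ∑ a, ∑ b, Sideband.psiStar cubatureWord MB MB_pos ν S i a l b * k a * k b =
      ν / (4 * π ^ 2) * ∑ j : Fin 26, ∑ j' : Fin 26, ek j k * ek j' k * Mre ν S j j' i l := by
  obtain ⟨m, hm⟩ : ∃ m : Fin 26 → Fin 26 → ℝ, ∀ j j', Mre ν S j j' i l = m j j' := ⟨_, fun _ _ => rfl⟩
  have he : ∀ j a, (((cubatureWord.stretch MB MB_pos).stretch (1 / ν) (one_div_pos.mpr hν)).phase j).e a = (cubatureWord.phase j).e a :=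
    fun _ _ => rfl
  obtain ⟨e, he'⟩ : ∃ e : Fin 26 → Fin 3 → ℝ, ∀ j a, (cubatureWord.phase j).e a = e j a := ⟨_, fun _ _ => rfl⟩
  have hΨ : ∀ a b : Fin 3, Sideband.psiStar cubatureWord MB MB_pos ν S i a l b = ν / (4 * π ^ 2) * ∑ j : Fin 26, ∑ j' : Fin 26,
      e j' a * e j b * m j j' := fun a b => by
    rw [Sideband.psiStar_of_pos cubatureWord MB MB_pos hν S]
    simp only [he, he', ← Mre_of_pos hν, hm]
  have hek : ∀ j, ek j k = ∑ a, e j a * k a := fun j => by simp only [ek, he']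
  simp only [hΨ, hm, hek]
  set C : ℝ := ν / (4 * π ^ 2) with hC
  have hL : ∑ a, ∑ b, C * (∑ j, ∑ j', e j' a * e j b * m j j') * k a * k b =
      ∑ a, ∑ b, ∑ j, ∑ j', C * e j' a * e j b * m j j' * k a * k b := by
    refine Finset.sum_congr rfl fun a _ => Finset.sum_congr rfl fun b _ => ?_
    rw [Finset.mul_sum, Finset.sum_mul, Finset.sum_mul]
    refine Finset.sum_congr rfl fun j _ => ?_
    rw [Finset.mul_sum, Finset.sum_mul, Finset.sum_mul]
    refine Finset.sum_congr rfl fun j' _ => ?_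
    ring
  have hR : C * ∑ j, ∑ j', (∑ a, e j a * k a) * (∑ b, e j' b * k b) * m j j' =
      ∑ j, ∑ j', ∑ a, ∑ b, C * e j' b * e j a * m j j' * k b * k a := by
    rw [Finset.mul_sum]
    refine Finset.sum_congr rfl fun j _ => ?_
    rw [Finset.mul_sum]
    refine Finset.sum_congr rfl fun j' _ => ?_
    rw [Finset.sum_mul_sum, Finset.sum_mul, Finset.mul_sum]
    refine Finset.sum_congr rfl fun a _ => ?_
    rw [Finset.sum_mul, Finset.mul_sum]
    refine Finset.sum_congr rfl fun b _ => ?_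
    ring
  rw [hL, hR, sum4_comm]
  refine Finset.sum_congr rfl fun j _ => Finset.sum_congr rfl fun j' _ => ?_
  exact Finset.sum_comm.trans (Finset.sum_congr rfl fun b _ => Finset.sum_congr rfl fun a _ => by ring)

/-- Entries of an `if … then c • Q else 0` matrix. [folklore] -/
theorem ite_smul_apply (P : Prop) [Decidable P] (c : ℝ) (Q : Matrix (Fin 3) (Fin 3) ℝ) (i l : Fin 3) :
    (if P then c • Q else (0 : Matrix (Fin 3) (Fin 3) ℝ)) i l = if P then c * Q i l else 0 := by
  split_ifs <;> simp [Matrix.smul_apply]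

/-- Entries of `freshMat`. [cite: ArmstrongVicol2025, §3] -/
theorem freshMat_apply (S : T4) (j j' : Fin 26) (i l : Fin 3) :
    freshMat S j j' i l = (if j = j' then slotCoef cubatureWord j * slotQ cubatureWord MB S j i l else 0) +
      ∑ l' : Fin 13, if j = sndSlot l' ∧ j' = fstSlot l' then slotCoef cubatureWord (fstSlot l') * pairQ S (fstSlot l') i l else 0 := by
  rw [freshMat_def, Matrix.add_apply, ite_smul_apply, Matrix.sum_apply]
  congr 1
  exact Finset.sum_congr rfl fun l' _ => ite_smul_apply _ _ _ _ _

/-- **The diagonal fresh parts re-summed over ordered pairs give `bsymb excQS`.** [cite: ArmstrongVicol2025, §3] -/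
theorem diag_fresh_sum (S : T4) (k p q : Fin 3 → ℝ) :
    ∑ j : Fin 26, ∑ j' : Fin 26, ek j k * ek j' k * ∑ i, ∑ l, p i * q l * (if j = j' then slotCoef cubatureWord j * slotQ cubatureWord MB S j i l else 0) =
      Torus.bsymb (excQS cubatureWord MB S) k p q := by
  rw [bsymb_excQS]
  refine Finset.sum_congr rfl fun j _ => ?_
  rw [Finset.sum_eq_single j]
  · simp only [if_true]
    have h : ∑ i, ∑ l, p i * q l * (slotCoef cubatureWord j * slotQ cubatureWord MB S j i l) =
        slotCoef cubatureWord j * ∑ i, ∑ l, p i * slotQ cubatureWord MB S j i l * q l := by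
      rw [Finset.mul_sum]
      refine Finset.sum_congr rfl fun i _ => ?_
      rw [Finset.mul_sum]
      refine Finset.sum_congr rfl fun l _ => ?_
      ring
    rw [h, show ek j k = ∑ a, (cubatureWord.phase j).e a * k a from rfl]
    ring
  · intro j' _ hj'
    simp only [Ne.symm hj', if_false, mul_zero, Finset.sum_const_zero]
  · intro h; exact absurd (Finset.mem_univ j) h

/-- `sndSlot l ≠ fstSlot l'` (odd vs even slot index). [folklore] -/
theorem sndSlot_ne_fstSlot (l l' : Fin 13) : sndSlot l ≠ fstSlot l' := by
  intro h
  have := congrArg Fin.val h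
  simp only [sndSlot, fstSlot] at this
  omega

/-- `fstSlot` is injective. [folklore] -/
theorem fstSlot_injective : Function.Injective fstSlot := by
  intro l l' h
  have := congrArg Fin.val h
  simp only [fstSlot] at this
  exact Fin.ext (by omega)

/-- `sndSlot` is injective. [folklore] -/
theorem sndSlot_injective : Function.Injective sndSlot := by
  intro l l' h
  have := congrArg Fin.val h
  simp only [sndSlot] at this
  exact Fin.ext (by omega)

/-- **The forward-pair fresh parts re-summed over ordered pairs give `bsymb pairQS`.** [cite: ArmstrongVicol2025, §3] -/
theorem pair_fresh_sum (S : T4) (k p q : Fin 3 → ℝ) :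
    ∑ j : Fin 26, ∑ j' : Fin 26, ek j k * ek j' k * ∑ i, ∑ l, p i * q l *
        (∑ l' : Fin 13, if j = sndSlot l' ∧ j' = fstSlot l' then slotCoef cubatureWord (fstSlot l') * pairQ S (fstSlot l') i l else 0) =
      Torus.bsymb (pairQS S) k p q := by
  classical
  rw [bsymb_pairQS]
  -- name the pair form
  obtain ⟨X, hX⟩ : ∃ X : Fin 13 → ℝ, ∀ l', ∑ i, ∑ l, p i * q l * (slotCoef cubatureWord (fstSlot l') * pairQ S (fstSlot l') i l) = X l' :=
    ⟨_, fun _ => rfl⟩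
  -- Step 1: the inner `(i,l)` sum of the `l'`-sum of `ite`s
  have h1 : ∀ j j' : Fin 26, ∑ i, ∑ l, p i * q l *
      (∑ l' : Fin 13, if j = sndSlot l' ∧ j' = fstSlot l' then slotCoef cubatureWord (fstSlot l') * pairQ S (fstSlot l') i l else 0) =
      ∑ l' : Fin 13, if j = sndSlot l' ∧ j' = fstSlot l' then X l' else 0 := by
    intro j j'
    calc ∑ i, ∑ l, p i * q l * (∑ l' : Fin 13, if j = sndSlot l' ∧ j' = fstSlot l' then slotCoef cubatureWord (fstSlot l') * pairQ S (fstSlot l') i l else 0)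
        = ∑ i, ∑ l, ∑ l' : Fin 13, (if j = sndSlot l' ∧ j' = fstSlot l' then p i * q l * (slotCoef cubatureWord (fstSlot l') * pairQ S (fstSlot l') i l) else 0) := by
          refine Finset.sum_congr rfl fun i _ => Finset.sum_congr rfl fun l _ => ?_
          rw [Finset.mul_sum]
          refine Finset.sum_congr rfl fun l' _ => ?_
          split_ifs <;> simp
      _ = ∑ l' : Fin 13, ∑ i, ∑ l, (if j = sndSlot l' ∧ j' = fstSlot l' then p i * q l * (slotCoef cubatureWord (fstSlot l') * pairQ S (fstSlot l') i l) else 0) :=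
          (Finset.sum_congr rfl fun i _ => Finset.sum_comm).trans Finset.sum_comm
      _ = ∑ l' : Fin 13, if j = sndSlot l' ∧ j' = fstSlot l' then X l' else 0 := by
          refine Finset.sum_congr rfl fun l' _ => ?_
          split_ifs with h
          · exact hX l'
          · simp
  -- Step 2: multiply by `ek ek` and move `l'` to the front
  have h2 : ∀ j j' : Fin 26, ek j k * ek j' k * ∑ l' : Fin 13, (if j = sndSlot l' ∧ j' = fstSlot l' then X l' else 0) =
      ∑ l' : Fin 13, if j = sndSlot l' ∧ j' = fstSlot l' then ek j k * ek j' k * X l' else 0 := by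
    intro j j'
    rw [Finset.mul_sum]
    refine Finset.sum_congr rfl fun l' _ => ?_
    split_ifs <;> simp
  simp only [h1, h2]
  rw [(Finset.sum_congr rfl fun j _ => Finset.sum_comm).trans Finset.sum_comm]
  refine Finset.sum_congr rfl fun l' _ => ?_
  -- Step 3: only `(j, j') = (sndSlot l', fstSlot l')` survives
  rw [Finset.sum_eq_single (sndSlot l')]
  · rw [Finset.sum_eq_single (fstSlot l')]
    · simp only [and_self, if_true]
      rw [← hX l']
      have h : ∑ i, ∑ l, p i * q l * (slotCoef cubatureWord (fstSlot l') * pairQ S (fstSlot l') i l) =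
          slotCoef cubatureWord (fstSlot l') * ∑ i, ∑ l, p i * pairQ S (fstSlot l') i l * q l := by
        rw [Finset.mul_sum]
        refine Finset.sum_congr rfl fun i _ => ?_
        rw [Finset.mul_sum]
        refine Finset.sum_congr rfl fun l _ => ?_
        ring
      rw [h]
      ring
    · intro j' _ hj'
      simp [hj']
    · intro h; exact absurd (Finset.mem_univ _) h
  · intro j _ hj
    refine Finset.sum_eq_zero fun j' _ => ?_
    simp [hj]
  · intro h; exact absurd (Finset.mem_univ _) h

/-! ## §2 `hstruct` -/

/-- **`hstruct`: THE SLOT-PAIR PRESENTATION OF THE TAIL** (`ν > 0`, all `k p q`):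
`bsymb (psiStar cubatureWord MB MB_pos ν S − excQS cubatureWord MB S − pairQS S) k p q = Σ_{j,j'} ek j k · ek j' k · tailKernel ν S p q j j'`.
[cite: ArmstrongVicol2025, §3 (renormalised diffusivity of one level)] [cite: MajdaKramer1999, §2.2.1.3 (55)] -/
theorem bsymb_tail_eq_slotPair {ν : ℝ} (hν : 0 < ν) (S : T4) (k p q : Fin 3 → ℝ) :
    Torus.bsymb (Sideband.psiStar cubatureWord MB MB_pos ν S - excQS cubatureWord MB S - pairQS S) k p q =
      ∑ j : Fin 26, ∑ j' : Fin 26, ek j k * ek j' k * tailKernel ν S p q j j' := by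
  rw [Torus.bsymb_sub, Torus.bsymb_sub]
  -- the `psiStar` part
  have hΨ : Torus.bsymb (Sideband.psiStar cubatureWord MB MB_pos ν S) k p q =
      ∑ j : Fin 26, ∑ j' : Fin 26, ek j k * ek j' k * ∑ i, ∑ l, p i * q l * (ν / (4 * π ^ 2) * Mre ν S j j' i l) := by
    rw [bsymb_eq_sum_sum]
    simp only [sum_sum_psiStar_mul_mul hν]
    -- `Σ_{i,l} p q (C Σ_{jj'} ek ek m) = Σ_{jj'} ek ek Σ_{il} p q C m`
    calc ∑ i, ∑ l, p i * q l * (ν / (4 * π ^ 2) * ∑ j : Fin 26, ∑ j' : Fin 26, ek j k * ek j' k * Mre ν S j j' i l)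
        = ∑ i, ∑ l, ∑ j : Fin 26, ∑ j' : Fin 26, ek j k * ek j' k * (p i * q l * (ν / (4 * π ^ 2) * Mre ν S j j' i l)) := by
          refine Finset.sum_congr rfl fun i _ => Finset.sum_congr rfl fun l _ => ?_
          rw [Finset.mul_sum, Finset.mul_sum]
          refine Finset.sum_congr rfl fun j _ => ?_
          rw [Finset.mul_sum, Finset.mul_sum]
          refine Finset.sum_congr rfl fun j' _ => ?_
          ring
      _ = ∑ j : Fin 26, ∑ j' : Fin 26, ∑ i, ∑ l, ek j k * ek j' k * (p i * q l * (ν / (4 * π ^ 2) * Mre ν S j j' i l)) := sum4_comm _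
      _ = _ := by
          refine Finset.sum_congr rfl fun j _ => Finset.sum_congr rfl fun j' _ => ?_
          rw [Finset.mul_sum]
          refine Finset.sum_congr rfl fun i _ => ?_
          rw [Finset.mul_sum]
  rw [hΨ, ← diag_fresh_sum S k p q, ← pair_fresh_sum S k p q, ← Finset.sum_sub_distrib, ← Finset.sum_sub_distrib]
  refine Finset.sum_congr rfl fun j _ => ?_
  rw [← Finset.sum_sub_distrib, ← Finset.sum_sub_distrib]
  refine Finset.sum_congr rfl fun j' _ => ?_
  rw [← mul_sub, ← mul_sub, ← Finset.sum_sub_distrib, ← Finset.sum_sub_distrib]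
  congr 1
  refine Finset.sum_congr rfl fun i _ => ?_
  rw [← Finset.sum_sub_distrib, ← Finset.sum_sub_distrib]
  refine Finset.sum_congr rfl fun l _ => ?_
  rw [freshMat_apply]
  ring

end Summit.AnomalousDissipation.AnomalousDissipation.Theorems.SolenoidalFractalHomogenisation.LagrangianStep.D1Tail

end
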